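import Mathlib
import Literature.Computability.MetaComplexity.SparseOneThresholdWires
import Literature.Computability.Complexity.CircuitPlug
import HarnessLib

/-!
# Every `S(n)`-sparse language is decided at depth `2` with `S(n)·(n+1)` threshold wires: the
quantitative method ceiling of sparse witnesses against threshold-circuit WIRES

`SparseOneThresholdWires.lean` shows that a `1`-sparse language is one LTF gate per length.  This
file does the general count: if length `n` carries at most `S(n)` words of `L` (for all large `n`),
then `L ∈ TCdWIRESae D s` for every depth `D ≥ 2` and every budget with `S(n)·n + S(n) ≤ s(n)`
eventually — a LAYER of `S(n)` equality tests (each ONE linear threshold gate of fan-in `n`,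
`ltf_eq_test`) under one `∨` gate (fan-in `S(n)`, an LTF gate), assembled with the tree's explicit
layer calculus `Complexity/CircuitPlug.lean` (`layerL`, `carries_layerL`, `carries_snoc`,
`toCircuit`).  In the vocabulary of census row R49 item 7 (Chen–Jin–Williams 2019, Thm. 1.1 item 7:
sparse `NP` languages versus `TC_{d+O(log 1/ε)}[n^{1+ε}]` wires, predicate
`ChenJinWilliams2019.SparseNPTCHardAt c₀ d ε`): for `ε > δ`, every language with eventually
`≤ ⌊n^δ⌋` words per length is INSIDE `TCdWIRESae (tcDepth c₀ d ε) ⌈n^{1+ε}⌉` once `d ≥ 2`; so a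
witness of the NEEDED cell (`ε > 0`) has MORE than `⌊n^δ⌋` words of length `n` at INFINITELY MANY
lengths, for every `δ < ε` (`frequently_dense_of_not_mem_TCdWIRESae`).  Polynomial density
`n^{ε−o(1)}` infinitely often is thus forced on any witness, while the row allows sparsity up to
`2^{n^β}`: the quantitative form of the METHOD CEILING of parts XXXIV/XXXVI of the census.

Main statements:
* `exists_slice_list` — the words of length `n` of a language, as a list of input vectors.
* `exists_circuit_memList` — for `ws : List (Fin n → Bool)`, a depth-`2` LTF circuit with
  `≤ |ws|·n + |ws|` wires deciding `x ∈ ws`.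
* `mem_TCdWIRESae_of_sparse` — `(∀ᶠ n, #Lₙ ≤ S n) → 2 ≤ D → (∀ᶠ n, S n·n + S n ≤ s n) →
  L ∈ TCdWIRESae D s`; `mem_TCdWIRESae_powCeil_of_sparse_rpow` (`S = ⌊n^δ⌋`, `s = ⌈n^{1+ε}⌉`,
  `δ < ε`); `frequently_dense_of_not_mem_TCdWIRESae` (the contrapositive, "dense i.o.");
  row forms in `namespace ChenJinWilliams2019`.

Everything is folklore and fully proved; no definition, no named fact.

References: L. Chen, C. Jin, R. Williams, *Hardness magnification for all sparse NP languages*,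
FOCS 2019 / ECCC TR19-118, Thm. 1.1 item 7; H. Vollmer, *Introduction to Circuit Complexity*
(Springer 1999), §1.2 (composition of circuits; the layer calculus); S. Jukna, *Boolean Function
Complexity* (Springer 2012), §11.10.
-/

open Finset Filter

namespace Literature.Computability.MetaComplexity

open Literature.Computability.Complexity Literature.Computability.Complexity.Circuit
open Literature.Computability.Complexity.GateList
open Literature.Computability.MetaComplexity.ChenJinWilliams2019
open scoped Classical

/-! ### The slice of a language as a list of input vectors -/

/-- The words of length `n` of `L`, read as input vectors, form a list of length the slice
cardinality which decides membership of `List.ofFn x`. [folklore] -/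
theorem exists_slice_list (L : Language Bool) (n : ℕ) :
    ∃ ws : List (Fin n → Bool), ws.length = {x : List Bool | x ∈ L ∧ x.length = n}.ncard ∧
      ∀ x : Fin n → Bool, List.ofFn x ∈ L ↔ x ∈ ws := by
  have hfin : {x : List Bool | x ∈ L ∧ x.length = n}.Finite :=
    (List.finite_length_eq Bool n).subset fun x hx => hx.2
  refine ⟨hfin.toFinset.toList.map fun w (i : Fin n) => w.getD i false, ?_, fun x => ?_⟩
  · rw [List.length_map, Finset.length_toList, Set.ncard_eq_toFinset_card _ hfin]
  · rw [List.mem_map]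
    simp only [Finset.mem_toList, Set.Finite.mem_toFinset, Set.mem_setOf_eq]
    constructor
    · intro hx
      refine ⟨List.ofFn x, ⟨hx, List.length_ofFn⟩, ?_⟩
      funext i
      simp
    · rintro ⟨w, ⟨hwL, hwn⟩, rfl⟩
      rwa [ofFn_getD_eq hwn]

/-! ### A depth-2 LTF circuit for membership in a list of words -/

/-- The equality test with a fixed word is an LTF gate. [folklore] -/
theorem isLTF_eqGate {n : ℕ} (w : Fin n → Bool) :
    GateFn.IsLTF ⟨n, fun x => decide (x = w)⟩ :=
  ltf_eq_test w

/-- **Membership in a list of `k` words of length `n` is decided by a depth-`2` circuit of LTF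
gates with at most `k·n + k` wires**: `k` equality tests (fan-in `n` each) under one `∨ₖ`.
[cite: Vollmer1999, §1.2 (composition); folklore] -/
theorem exists_circuit_memList {n : ℕ} (ws : List (Fin n → Bool)) :
    ∃ C : Circuit (Fin n), C.IsOver ltfBasis ∧ C.acDepth ≤ 2 ∧
      C.wires ≤ ws.length * n + ws.length ∧ ∀ x, C.eval x = decide (x ∈ ws) := by
  -- the layer of equality tests
  let Cs : List (Circuit (Fin n)) :=
    ws.map fun w => Circuit.single (⟨n, fun y => decide (y = w)⟩ : GateFn) (Equiv.refl (Fin n))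
  have hCs_len : Cs.length = ws.length := by simp [Cs]
  have hCs_get : ∀ (j : ℕ) (hj : j < Cs.length),
      Cs[j] = Circuit.single (⟨n, fun y => decide (y = ws[j]'(hCs_len ▸ hj))⟩ : GateFn)
        (Equiv.refl (Fin n)) := by
    intro j hj
    simp [Cs]
  let gs₀ : List (Gate (Fin n)) := (layerL Cs).1
  let outs : List (Fin n ⊕ ℕ) := (layerL Cs).2
  have houts_len : outs.length = ws.length := by simp [outs, hCs_len]
  -- each output wire of the layer carries one equality test, at depth `1`
  have hcar : ∀ (j : ℕ) (hj : j < ws.length),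
      Carries gs₀ (outs[j]'(by rw [houts_len]; exact hj)) (fun x => decide (x = ws[j])) 1 := by
    intro j hj
    have hjC : j < Cs.length := by rw [hCs_len]; exact hj
    have hd : (Cs[j]).acDepth ≤ 1 := by
      rw [hCs_get j hjC]
      exact ChenTell2019.acDepth_single_le _ _
    refine (carries_layerL Cs j hjC hd).congr fun x => ?_
    rw [hCs_get j hjC, Circuit.eval_single]
    rfl
  -- the `∨` gate on top of the layer
  let g : Gate (Fin n) :=
    ⟨ws.length, fun v => decide (∃ j, v j = true), fun j => outs[j.1]'(by rw [houts_len]; exact j.2)⟩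
  have hc : Carries (gs₀ ++ [g]) (.inr gs₀.length) (fun x => decide (x ∈ ws)) 2 := by
    refine carries_snoc gs₀ g (fun x => ?_) ?_
    · have hv : ∀ j : Fin ws.length, wireOf x (vals gs₀ x) (g.args j) = decide (x = ws[j.1]) :=
        fun j => (hcar j.1 j.2).eval x
      show decide (∃ j : Fin ws.length, wireOf x (vals gs₀ x) (g.args j) = true) = decide (x ∈ ws)
      refine decide_eq_decide.2 ?_
      simp only [hv, decide_eq_true_eq]
      constructor
      · rintro ⟨j, hj⟩
        rw [hj]
        exact List.getElem_mem _
      · intro hx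
        obtain ⟨j, hj, hjx⟩ := List.getElem_of_mem hx
        exact ⟨⟨j, hj⟩, hjx.symm⟩
    · have h1 : acWeight g.fn ≤ 1 := by
        unfold acWeight
        split_ifs <;> simp
      have h2 : (univ.sup fun a : Fin ws.length =>
          wireDepthOf (wdepths acWeight gs₀) (g.args a)) ≤ 1 :=
        Finset.sup_le fun a _ => (hcar a.1 a.2).depth
      exact add_le_add h1 h2
  have hwf : WF (gs₀ ++ [g]) := wf_snoc (wf_layerL Cs) fun a => (hcar a.1 a.2).outOK
  refine ⟨toCircuit (gs₀ ++ [g]) (.inr gs₀.length) hwf hc.outOK, ?_, acDepth_toCircuit_le hwf hc,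
    ?_, fun x => eval_toCircuit hwf hc x⟩
  · -- gates: equality tests and one `∨`, all LTF
    refine isOver_toCircuit hwf hc.outOK (fn_mem_snoc (fn_mem_layerL fun C hC => ?_) ?_)
    · obtain ⟨w, -, rfl⟩ := List.mem_map.1 hC
      exact Circuit.single_isOver (isLTF_eqGate w) _
    · exact isLTF_or ws.length
  · -- wires: `k` gates of fan-in `n`, plus fan-in `k`
    have harity : ∀ g' ∈ gs₀, g'.arity = n := by
      have h := fn_mem_layerL (B := {f : GateFn | f.1 = n}) (Cs := Cs) fun C hC => by
        obtain ⟨w, -, rfl⟩ := List.mem_map.1 hC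
        exact Circuit.single_isOver (B := {f : GateFn | f.1 = n}) rfl _
      exact fun g' hg' => h g' hg'
    have hlen : gs₀.length = ws.length := by
      show (layerL Cs).1.length = ws.length
      rw [length_layerL_fst]
      have hmap : Cs.map Circuit.size = ws.map fun _ => 1 := by
        simp [Cs, Function.comp_def]
      rw [hmap, List.map_const', List.sum_replicate, smul_eq_mul, mul_one]
    have hsum : (gs₀.map Gate.arity).sum ≤ ws.length * n :=
      calc (gs₀.map Gate.arity).sum ≤ (gs₀.map Gate.arity).length • n :=
            List.sum_le_card_nsmul _ _ fun a ha => by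
              obtain ⟨g', hg', rfl⟩ := List.mem_map.1 ha
              exact (harity g' hg').le
        _ = ws.length * n := by rw [List.length_map, hlen, smul_eq_mul]
    show (((gs₀ ++ [g]).map Gate.arity).sum) ≤ ws.length * n + ws.length
    rw [List.map_append, List.sum_append]
    show (gs₀.map Gate.arity).sum + ([g].map Gate.arity).sum ≤ ws.length * n + ws.length
    have hg : ([g].map Gate.arity).sum = ws.length := by simp [g]
    rw [hg]
    exact Nat.add_le_add_right hsum _

/-! ### The quantitative method ceiling -/

/-- **Every language with eventually at most `S(n)` words per length lies in `TCdWIRESae D s`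
for every depth `D ≥ 2` and every wire budget with `S(n)·n + S(n) ≤ s(n)` eventually.**
[folklore] -/
theorem mem_TCdWIRESae_of_sparse {L : Language Bool} {S : ℕ → ℕ}
    (hL : ∃ n₁ : ℕ, ∀ n ≥ n₁, {x : List Bool | x ∈ L ∧ x.length = n}.ncard ≤ S n) {D : ℕ}
    (hD : 2 ≤ D) {s : ℕ → ℕ} (hs : ∃ n₀ : ℕ, ∀ n ≥ n₀, S n * n + S n ≤ s n) :
    L ∈ TCdWIRESae D s := by
  obtain ⟨n₁, hn₁⟩ := hL
  obtain ⟨n₀, hn₀⟩ := hs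
  choose ws hlen hmem using fun n => exists_slice_list L n
  choose C hover hdepth hwires heval using fun n => exists_circuit_memList (ws n)
  refine ⟨C, ⟨max n₀ n₁, fun n hn => ⟨hover n, (hdepth n).trans hD, ?_⟩⟩, fun x => ?_⟩
  · have hk : (ws n).length ≤ S n := (hlen n).le.trans (hn₁ n (le_of_max_le_right hn))
    calc (C n).wires ≤ (ws n).length * n + (ws n).length := hwires n
      _ ≤ S n * n + S n := Nat.add_le_add (Nat.mul_le_mul_right _ hk) hk
      _ ≤ s n := hn₀ n (le_of_max_le_left hn)
  · rw [heval]
    by_cases hx : x ∈ L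
    · rw [((L : Set (List Bool)).mem_iff_boolIndicator x).1 hx]
      exact decide_eq_true ((hmem _ _).1 (by rwa [List.ofFn_get]))
    · rw [((L : Set (List Bool)).notMem_iff_boolIndicator x).1 hx]
      exact decide_eq_false fun h => hx (by simpa only [List.ofFn_get] using (hmem _ _).2 h)

/-- The `IsSparse` form: every `S`-sparse language is in `TCdWIRESae D s` for `D ≥ 2` and
`S(n)·n + S(n) ≤ s(n)` eventually. [folklore] -/
theorem mem_TCdWIRESae_of_isSparse {L : Language Bool} {S : ℕ → ℕ} (hL : IsSparse S L) {D : ℕ}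
    (hD : 2 ≤ D) {s : ℕ → ℕ} (hs : ∃ n₀ : ℕ, ∀ n ≥ n₀, S n * n + S n ≤ s n) :
    L ∈ TCdWIRESae D s :=
  mem_TCdWIRESae_of_sparse ⟨0, fun n _ => hL n⟩ hD hs

/-- The numerics of the polynomial-sparsity instance: for `δ < ε`, eventually
`⌊n^δ⌋·n + ⌊n^δ⌋ ≤ ⌈n^{1+ε}⌉`. [folklore] -/
theorem eventually_floor_rpow_mul_add_le_powCeil {δ ε : ℝ} (hδε : δ < ε) :
    ∃ n₀ : ℕ, ∀ n ≥ n₀, ⌊(n : ℝ) ^ δ⌋₊ * n + ⌊(n : ℝ) ^ δ⌋₊ ≤ powCeil (1 + ε) n := by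
  have h2 : ∀ᶠ n : ℕ in atTop, (2 : ℝ) ≤ (n : ℝ) ^ (ε - δ) :=
    ((tendsto_rpow_atTop (by linarith)).comp tendsto_natCast_atTop_atTop).eventually_ge_atTop 2
  obtain ⟨n₀, hn₀⟩ := eventually_atTop.1 (h2.and (eventually_ge_atTop 1))
  refine ⟨n₀, fun n hn => ?_⟩
  obtain ⟨h2n, h1n⟩ := hn₀ n hn
  have hn0 : (0 : ℝ) < n := by exact_mod_cast h1n
  have ha : (⌊(n : ℝ) ^ δ⌋₊ : ℝ) ≤ (n : ℝ) ^ δ := Nat.floor_le (Real.rpow_nonneg hn0.le _)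
  have hδ0 : (0 : ℝ) ≤ (n : ℝ) ^ δ := Real.rpow_nonneg hn0.le _
  have hkey : ((⌊(n : ℝ) ^ δ⌋₊ * n + ⌊(n : ℝ) ^ δ⌋₊ : ℕ) : ℝ) ≤ (n : ℝ) ^ (1 + ε) := by
    push_cast
    have hn1 : (1 : ℝ) ≤ n := by exact_mod_cast h1n
    calc (⌊(n : ℝ) ^ δ⌋₊ : ℝ) * n + ⌊(n : ℝ) ^ δ⌋₊
        ≤ (n : ℝ) ^ δ * n + (n : ℝ) ^ δ := by gcongr
      _ ≤ (n : ℝ) ^ δ * n + (n : ℝ) ^ δ * n := by nlinarith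
      _ = 2 * ((n : ℝ) ^ δ * n) := by ring
      _ ≤ (n : ℝ) ^ (ε - δ) * ((n : ℝ) ^ δ * n) := by gcongr
      _ = (n : ℝ) ^ (1 + ε) := by
          rw [← mul_assoc, ← Real.rpow_add hn0, show ε - δ + δ = ε by ring,
            show (1 : ℝ) + ε = ε + 1 by ring, Real.rpow_add_one hn0.ne']
  unfold powCeil
  exact_mod_cast hkey.trans (Nat.le_ceil _)

/-- **Polynomial sparsity is inside at exponent `1 + ε`**: for `δ < ε` and `D ≥ 2`, every
language with eventually at most `⌊n^δ⌋` words per length lies in `TCdWIRESae D ⌈n^{1+ε}⌉`.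
[folklore] -/
theorem mem_TCdWIRESae_powCeil_of_sparse_rpow {L : Language Bool} {δ ε : ℝ} (hδε : δ < ε)
    (hL : ∃ n₁ : ℕ, ∀ n ≥ n₁, {x : List Bool | x ∈ L ∧ x.length = n}.ncard ≤ ⌊(n : ℝ) ^ δ⌋₊)
    {D : ℕ} (hD : 2 ≤ D) : L ∈ TCdWIRESae D (powCeil (1 + ε)) :=
  mem_TCdWIRESae_of_sparse hL hD (eventually_floor_rpow_mul_add_le_powCeil hδε)

/-- **The quantitative method ceiling, contrapositive ("dense infinitely often").** If `L` is
outside `TCdWIRESae D ⌈n^{1+ε}⌉` for some `D ≥ 2`, then for every `δ < ε` the language has MORE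
than `⌊n^δ⌋` words of length `n` at infinitely many lengths `n`. [folklore] -/
theorem frequently_dense_of_not_mem_TCdWIRESae {L : Language Bool} {D : ℕ} (hD : 2 ≤ D) {ε : ℝ}
    (h : L ∉ TCdWIRESae D (powCeil (1 + ε))) {δ : ℝ} (hδε : δ < ε) :
    ∃ᶠ n : ℕ in atTop, ⌊(n : ℝ) ^ δ⌋₊ < {x : List Bool | x ∈ L ∧ x.length = n}.ncard := by
  by_contra hcon
  rw [Filter.not_frequently] at hcon
  obtain ⟨n₁, hn₁⟩ := eventually_atTop.1 hcon
  exact h (mem_TCdWIRESae_powCeil_of_sparse_rpow hδε ⟨n₁, fun n hn => not_lt.1 (hn₁ n hn)⟩ hD)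

namespace ChenJinWilliams2019

/-- **Row R49 item 7, quantitative method ceiling.** For `δ < ε`, every `c₀` and every `d ≥ 2`,
every language with eventually at most `⌊n^δ⌋` words per length is INSIDE
`TCdWIRESae (tcDepth c₀ d ε) ⌈n^{1+ε}⌉`. [cite: ChenJinWilliams2019, Thm. 1.1 item 7
(hypothesis shape; ceiling folklore)] -/
theorem mem_TCdWIRESae_tcDepth_of_sparse_rpow {L : Language Bool} {δ ε : ℝ} (hδε : δ < ε)
    (hL : ∃ n₁ : ℕ, ∀ n ≥ n₁, {x : List Bool | x ∈ L ∧ x.length = n}.ncard ≤ ⌊(n : ℝ) ^ δ⌋₊)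
    (c₀ : ℕ) {d : ℕ} (hd : 2 ≤ d) :
    L ∈ TCdWIRESae (tcDepth c₀ d ε) (powCeil (1 + ε)) :=
  mem_TCdWIRESae_powCeil_of_sparse_rpow hδε hL (hd.trans (le_tcDepth c₀ d ε))

/-- **A witness of `SparseNPTCHardAt c₀ d ε` (`d ≥ 2`) is dense infinitely often**: any language
outside `TCdWIRESae (tcDepth c₀ d ε) ⌈n^{1+ε}⌉` has, for every `δ < ε`, more than `⌊n^δ⌋` words
of length `n` at infinitely many `n` — while the row allows `2^{n^β}`-sparsity. [folklore] -/
theorem frequently_dense_of_witness (c₀ : ℕ) {d : ℕ} (hd : 2 ≤ d) {ε : ℝ} {L : Language Bool}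
    (h : L ∉ TCdWIRESae (tcDepth c₀ d ε) (powCeil (1 + ε))) {δ : ℝ} (hδε : δ < ε) :
    ∃ᶠ n : ℕ in atTop, ⌊(n : ℝ) ^ δ⌋₊ < {x : List Bool | x ∈ L ∧ x.length = n}.ncard :=
  frequently_dense_of_not_mem_TCdWIRESae (hd.trans (le_tcDepth c₀ d ε)) h hδε

end ChenJinWilliams2019

end Literature.Computability.MetaComplexity
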